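import Summits.Ventures.Crystal3D.Bulk.HalfTanCert
import Mathlib.Tactic.Linarith
import Mathlib.Tactic.Positivity
import Mathlib.Tactic.Ring
import Mathlib.Tactic.Push
import HarnessLib

/-!
# Soundness of the trig-free Tammes-bridge certificate, I: enclosures and the box rule

Venture `Crystal3D` (cell `pub-crystal3d`, phase 2; seat p3, mathematics of seat idea-2, `phase2/idea2/TAMMES-BRIDGE.md` §F).
`HalfTanCert.lean` replays idea-2's box certificate by compiled evaluation. This file proves that the box rule is SOUND over
the reals: (s1) the five rational interval operations `iadd`, `isub`, `imul`, `iscaleNN` (nonnegative factor), `isq` enclose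
the corresponding real operations under the cast `ℚ → ℝ` (`I.mem`); (s2) `decideBox ka kb p q r s ≠ 0` implies, for every real
point of the box `[p, q] × [r, s]` with profile values `W₁ ∈ [Waff ka p, Waff ka q]`, `W₂ ∈ [Waff kb r, Waff kb s]`,
`W₁, W₂, w₁, w₂ ≥ 0`, every `c ∈ [-1, 1]` satisfying the original-pair constraint `4 w₁ w₂ c ≤ E(w₁, w₂)`, the target inequality
`T(W₁, W₂, c) ≤ 0` — by the case analysis (R) `T(c) ≤ T(1) = RAD ≤ 0`, (I) `E + 4 w₁ w₂ < 0` contradicts `c ≥ -1`,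
(G) `4 w₁ w₂ · T(c) ≤ GEN ≤ 0` with `w₁ w₂ > 0` (§F.2); (s3) `certBox ka kb fuel p q r s = true` implies the same on the whole box
for the affine profile values `WaffR ka w₁`, `WaffR kb w₂` (induction on the bisection fuel; the pieces' slopes are `≥ 0`).
The assembly into `HalfTanWitness 0.63 0.957` (piece location, symmetry, pole bound) is `HalfTanWitness.lean`.
HONEST FRAMING: elementary real algebra; no geometry, no trigonometry; standard axioms (the `native_decide` facts of
`HalfTanCert.lean` are used only in the next file).
-/

namespace Summit.Ventures.Crystal3D.TammesBridge

namespace CertW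

/-! ### (s1) Enclosures -/

/-- A real number lies in the rational interval `a`. [folklore] -/
def I.mem (a : I) (x : ℝ) : Prop := (a.lo : ℝ) ≤ x ∧ x ≤ (a.hi : ℝ)

/-- The degenerate interval `[x, x]` contains `x`. [folklore] -/
theorem mem_point (x : ℚ) : I.mem ⟨x, x⟩ (x : ℝ) := ⟨le_rfl, le_rfl⟩

/-- Membership from two real inequalities. [folklore] -/
theorem mem_mk {p q : ℚ} {x : ℝ} (h1 : (p : ℝ) ≤ x) (h2 : x ≤ (q : ℝ)) : I.mem ⟨p, q⟩ x := ⟨h1, h2⟩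

/-- `iadd` encloses `+`. [folklore] -/
theorem mem_iadd {a b : I} {x y : ℝ} (ha : a.mem x) (hb : b.mem y) : (iadd a b).mem (x + y) := by
  obtain ⟨ha1, ha2⟩ := ha
  obtain ⟨hb1, hb2⟩ := hb
  constructor <;> simp only [iadd, Rat.cast_add] <;> linarith

/-- `isub` encloses `-`. [folklore] -/
theorem mem_isub {a b : I} {x y : ℝ} (ha : a.mem x) (hb : b.mem y) : (isub a b).mem (x - y) := by
  obtain ⟨ha1, ha2⟩ := ha
  obtain ⟨hb1, hb2⟩ := hb
  constructor <;> simp only [isub, Rat.cast_sub] <;> linarith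

/-- `iscaleNN c` encloses multiplication by a nonnegative constant `c`. [folklore] -/
theorem mem_iscaleNN {c : ℚ} (hc : 0 ≤ c) {a : I} {x : ℝ} (ha : a.mem x) : (iscaleNN c a).mem ((c : ℝ) * x) := by
  obtain ⟨ha1, ha2⟩ := ha
  have hc' : (0 : ℝ) ≤ (c : ℝ) := by exact_mod_cast hc
  constructor <;> simp only [iscaleNN, Rat.cast_mul]
  · exact mul_le_mul_of_nonneg_left ha1 hc'
  · exact mul_le_mul_of_nonneg_left ha2 hc'

/-- One factor in an interval: `x * y` lies between the endpoint products `l * y`, `h * y`. [folklore] -/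
theorem min_mul_le_of_mem {l h x : ℝ} (h1 : l ≤ x) (h2 : x ≤ h) (y : ℝ) :
    min (l * y) (h * y) ≤ x * y ∧ x * y ≤ max (l * y) (h * y) := by
  rcases le_total 0 y with hy | hy
  · exact ⟨(min_le_left _ _).trans (mul_le_mul_of_nonneg_right h1 hy),
      (mul_le_mul_of_nonneg_right h2 hy).trans (le_max_right _ _)⟩
  · exact ⟨(min_le_right _ _).trans (mul_le_mul_of_nonpos_right h2 hy),
      (mul_le_mul_of_nonpos_right h1 hy).trans (le_max_left _ _)⟩

/-- `imul` encloses `*` (the four corner products). [folklore] -/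
theorem mem_imul {a b : I} {x y : ℝ} (ha : a.mem x) (hb : b.mem y) : (imul a b).mem (x * y) := by
  obtain ⟨ha1, ha2⟩ := ha
  obtain ⟨hb1, hb2⟩ := hb
  -- x * y between min/max of (a.lo * y), (a.hi * y)
  obtain ⟨h1, h2⟩ := min_mul_le_of_mem ha1 ha2 y
  -- a.lo * y between the corner products a.lo * b.lo, a.lo * b.hi; same for a.hi * y
  obtain ⟨h3, h4⟩ := min_mul_le_of_mem hb1 hb2 (a.lo : ℝ)
  obtain ⟨h5, h6⟩ := min_mul_le_of_mem hb1 hb2 (a.hi : ℝ)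
  rw [mul_comm (y : ℝ), mul_comm ((b.lo : ℚ) : ℝ), mul_comm ((b.hi : ℚ) : ℝ)] at h3 h4
  rw [mul_comm (y : ℝ), mul_comm ((b.lo : ℚ) : ℝ), mul_comm ((b.hi : ℚ) : ℝ)] at h5 h6
  constructor
  · simp only [imul, Rat.cast_min, Rat.cast_mul]
    -- min (min p1 p2) (min p3 p4) ≤ x * y
    rcases min_choice ((a.lo : ℝ) * y) ((a.hi : ℝ) * y) with hm | hm
    · rw [hm] at h1
      exact (min_le_left _ _).trans (h3.trans h1)
    · rw [hm] at h1
      exact (min_le_right _ _).trans (h5.trans h1)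
  · simp only [imul, Rat.cast_max, Rat.cast_mul]
    rcases max_choice ((a.lo : ℝ) * y) ((a.hi : ℝ) * y) with hm | hm
    · rw [hm] at h2
      exact (h2.trans h4).trans (le_max_left _ _)
    · rw [hm] at h2
      exact (h2.trans h6).trans (le_max_right _ _)

/-- `isq` encloses squaring. [folklore] -/
theorem mem_isq {a : I} {x : ℝ} (ha : a.mem x) : (isq a).mem (x ^ 2) := by
  obtain ⟨ha1, ha2⟩ := ha
  unfold isq
  split_ifs with h0 h1
  · have h0' : (0 : ℝ) ≤ (a.lo : ℝ) := by exact_mod_cast h0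
    constructor <;> simp only [Rat.cast_mul] <;> nlinarith
  · have h1' : ((a.hi : ℚ) : ℝ) ≤ 0 := by exact_mod_cast h1
    constructor <;> simp only [Rat.cast_mul] <;> nlinarith
  · push Not at h0 h1
    have h0' : ((a.lo : ℚ) : ℝ) < 0 := by exact_mod_cast h0
    have h1' : (0 : ℝ) < (a.hi : ℝ) := by exact_mod_cast h1
    constructor
    · simp only [Rat.cast_zero]
      positivity
    · simp only [Rat.cast_max, Rat.cast_mul]
      rcases le_total 0 x with hx | hx
      · exact le_trans (by nlinarith) (le_max_right _ _)
      · exact le_trans (by nlinarith) (le_max_left _ _)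

/-! ### (s2) The box rule -/

/-- The real affine function of piece `k` (the cast of `Waff k`). [folklore] -/
noncomputable def WaffR (k : ℕ) (x : ℝ) : ℝ := (nodesV[k]! : ℝ) + (slope k : ℝ) * (x - (nodesW[k]! : ℝ))

/-- `WaffR` is the cast of `Waff` on rationals. [folklore] -/
theorem WaffR_cast (k : ℕ) (x : ℚ) : WaffR k (x : ℝ) = (Waff k x : ℝ) := by
  simp only [WaffR, Waff, Rat.cast_add, Rat.cast_mul, Rat.cast_sub]

/-- The target polynomial `T(W₁, W₂, c) = (1 - W₁²)(1 - W₂²) + 4 W₁ W₂ c - c_s (1 + W₁²)(1 + W₂²)` (image chord `≥ s` iff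
`T ≤ 0`). [folklore] -/
noncomputable def Tpoly (W₁ W₂ c : ℝ) : ℝ :=
  (1 - W₁ ^ 2) * (1 - W₂ ^ 2) + 4 * W₁ * W₂ * c - (cs : ℝ) * ((1 + W₁ ^ 2) * (1 + W₂ ^ 2))

/-- The constraint polynomial `E(w₁, w₂) = -1/2 + (3/2)(w₁² + w₂²) - (1/2) w₁² w₂²` (original pair `≥ 60°` iff
`4 w₁ w₂ c ≤ E`). [folklore] -/
noncomputable def Epoly (w₁ w₂ : ℝ) : ℝ := -1 / 2 + 3 / 2 * (w₁ ^ 2 + w₂ ^ 2) - 1 / 2 * (w₁ ^ 2 * w₂ ^ 2)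

/-- `0 ≤ 1 - c_s` and `0 ≤ 1 + c_s` (and the numeric value of `c_s`). [folklore] -/
theorem cs_bounds : 0 ≤ 1 - cs ∧ 0 ≤ 1 + cs := by
  constructor <;> norm_num [cs, sChord]

/-- **Soundness of the box decision (§F.2).** [folklore] -/
theorem decideBox_sound {ka kb : ℕ} {p q r s : ℚ} (h : decideBox ka kb p q r s ≠ 0) {w₁ w₂ W₁ W₂ c : ℝ}
    (hw₁ : I.mem ⟨p, q⟩ w₁) (hw₂ : I.mem ⟨r, s⟩ w₂) (hW₁ : I.mem ⟨Waff ka p, Waff ka q⟩ W₁)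
    (hW₂ : I.mem ⟨Waff kb r, Waff kb s⟩ W₂) (hw₁0 : 0 ≤ w₁) (hw₂0 : 0 ≤ w₂) (hW₁0 : 0 ≤ W₁) (hW₂0 : 0 ≤ W₂)
    (hc1 : -1 ≤ c) (hc2 : c ≤ 1) (hcon : 4 * w₁ * w₂ * c ≤ Epoly w₁ w₂) : Tpoly W₁ W₂ c ≤ 0 := by
  -- the enclosures used by the checker
  have hW1s := mem_isq hW₁
  have hW2s := mem_isq hW₂
  have hW12 := mem_imul hW₁ hW₂
  have hRAD : (iadd (iadd (isub ⟨1 - cs, 1 - cs⟩ (iscaleNN (1 + cs) (iadd (isq ⟨Waff ka p, Waff ka q⟩)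
      (isq ⟨Waff kb r, Waff kb s⟩)))) (iscaleNN (1 - cs) (imul (isq ⟨Waff ka p, Waff ka q⟩) (isq ⟨Waff kb r, Waff kb s⟩))))
      (iscaleNN 4 (imul ⟨Waff ka p, Waff ka q⟩ ⟨Waff kb r, Waff kb s⟩))).mem
      ((((1 - cs : ℚ) : ℝ) - ((1 + cs : ℚ) : ℝ) * (W₁ ^ 2 + W₂ ^ 2)) + ((1 - cs : ℚ) : ℝ) * (W₁ ^ 2 * W₂ ^ 2) +
        ((4 : ℚ) : ℝ) * (W₁ * W₂)) :=
    mem_iadd (mem_iadd (mem_isub (mem_point _) (mem_iscaleNN cs_bounds.2 (mem_iadd hW1s hW2s)))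
      (mem_iscaleNN cs_bounds.1 (mem_imul hW1s hW2s))) (mem_iscaleNN (by norm_num) hW12)
  have hw1s := mem_isq hw₁
  have hw2s := mem_isq hw₂
  have hw12 := mem_imul hw₁ hw₂
  have hE : (isub (iadd ⟨-1/2, -1/2⟩ (iscaleNN (3/2) (iadd (isq ⟨p, q⟩) (isq ⟨r, s⟩))))
      (iscaleNN (1/2) (imul (isq ⟨p, q⟩) (isq ⟨r, s⟩)))).mem
      ((((-1/2 : ℚ) : ℝ) + ((3/2 : ℚ) : ℝ) * (w₁ ^ 2 + w₂ ^ 2)) - ((1/2 : ℚ) : ℝ) * (w₁ ^ 2 * w₂ ^ 2)) :=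
    mem_isub (mem_iadd (mem_point _) (mem_iscaleNN (by norm_num) (mem_iadd hw1s hw2s)))
      (mem_iscaleNN (by norm_num) (mem_imul hw1s hw2s))
  have hfeas := mem_iadd hE (mem_iscaleNN (show (0 : ℚ) ≤ 4 by norm_num) hw12)
  have hF := mem_isub hE (mem_iscaleNN (show (0 : ℚ) ≤ 4 by norm_num) hw12)
  have hGEN := mem_iadd (mem_iscaleNN (show (0 : ℚ) ≤ 4 by norm_num) (mem_imul hw12 hRAD))
    (mem_iscaleNN (show (0 : ℚ) ≤ 4 by norm_num) (mem_imul hW12 hF))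
  -- numeric identities relating the enclosed expressions to `Tpoly` / `Epoly`
  have hRADval : (((1 - cs : ℚ) : ℝ) - ((1 + cs : ℚ) : ℝ) * (W₁ ^ 2 + W₂ ^ 2)) + ((1 - cs : ℚ) : ℝ) * (W₁ ^ 2 * W₂ ^ 2) +
      ((4 : ℚ) : ℝ) * (W₁ * W₂) = Tpoly W₁ W₂ 1 := by
    simp only [Tpoly, Rat.cast_sub, Rat.cast_add, Rat.cast_one, Rat.cast_ofNat]
    ring
  have hEval : (((-1/2 : ℚ) : ℝ) + ((3/2 : ℚ) : ℝ) * (w₁ ^ 2 + w₂ ^ 2)) - ((1/2 : ℚ) : ℝ) * (w₁ ^ 2 * w₂ ^ 2) = Epoly w₁ w₂ := by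
    simp only [Epoly]
    push_cast
    ring
  have hmono : Tpoly W₁ W₂ c ≤ Tpoly W₁ W₂ 1 := by
    simp only [Tpoly]
    nlinarith [mul_nonneg hW₁0 hW₂0, mul_nonneg (mul_nonneg hW₁0 hW₂0) (sub_nonneg.2 hc2)]
  unfold decideBox at h
  simp only [ne_eq] at h
  split_ifs at h with h1 h2 h3 h4
  · -- (R): RAD.hi ≤ 0
    have hhi := hRAD.2
    rw [hRADval] at hhi
    have h1' := (Rat.cast_le (K := ℝ)).2 h1
    rw [Rat.cast_zero] at h1'
    exact hmono.trans (hhi.trans h1')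
  · -- (I): E + 4 w₁ w₂ < 0 is impossible
    exfalso
    have hhi := hfeas.2
    rw [hEval] at hhi
    have h2' := (Rat.cast_lt (K := ℝ)).2 h2
    rw [Rat.cast_zero] at h2'
    have : Epoly w₁ w₂ + ((4 : ℚ) : ℝ) * (w₁ * w₂) < 0 := lt_of_le_of_lt hhi h2'
    simp only [Rat.cast_ofNat] at this
    nlinarith [mul_nonneg hw₁0 hw₂0, mul_nonneg (mul_nonneg hw₁0 hw₂0) (show (0:ℝ) ≤ c + 1 by linarith)]
  · -- (G): F.hi ≤ 0, 0 < p, 0 < r, GEN.hi ≤ 0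
    obtain ⟨-, hp0, hr0⟩ := h3
    have hp' : (0 : ℝ) < (p : ℝ) := by exact_mod_cast hp0
    have hr' : (0 : ℝ) < (r : ℝ) := by exact_mod_cast hr0
    have hw₁pos : 0 < w₁ := lt_of_lt_of_le hp' hw₁.1
    have hw₂pos : 0 < w₂ := lt_of_lt_of_le hr' hw₂.1
    have hGhi := hGEN.2
    rw [hRADval, hEval] at hGhi
    have h4' := (Rat.cast_le (K := ℝ)).2 h4
    rw [Rat.cast_zero] at h4'
    have hG : ((4 : ℚ) : ℝ) * ((w₁ * w₂) * Tpoly W₁ W₂ 1) +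
        ((4 : ℚ) : ℝ) * ((W₁ * W₂) * (Epoly w₁ w₂ - ((4 : ℚ) : ℝ) * (w₁ * w₂))) ≤ 0 := hGhi.trans h4'
    simp only [Rat.cast_ofNat] at hG
    -- 4 w₁ w₂ T(c) ≤ GEN ≤ 0
    have hkey : 4 * (w₁ * w₂) * Tpoly W₁ W₂ c ≤
        4 * ((w₁ * w₂) * Tpoly W₁ W₂ 1) + 4 * ((W₁ * W₂) * (Epoly w₁ w₂ - 4 * (w₁ * w₂))) := by
      have hWW : 0 ≤ W₁ * W₂ := mul_nonneg hW₁0 hW₂0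
      have hcE : 4 * (W₁ * W₂) * (4 * w₁ * w₂ * c) ≤ 4 * (W₁ * W₂) * Epoly w₁ w₂ :=
        mul_le_mul_of_nonneg_left hcon (by positivity)
      have : 4 * (w₁ * w₂) * Tpoly W₁ W₂ c =
          4 * ((w₁ * w₂) * Tpoly W₁ W₂ 1) + 4 * ((W₁ * W₂) * (4 * w₁ * w₂ * c - 4 * (w₁ * w₂))) := by
        simp only [Tpoly]; ring
      rw [this]
      nlinarith
    have hprod : 4 * (w₁ * w₂) * Tpoly W₁ W₂ c ≤ 0 := hkey.trans hG
    have hpos : 0 < 4 * (w₁ * w₂) := by positivity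
    by_contra hT
    push Not at hT
    have := mul_pos hpos hT
    linarith
  · exact absurd rfl h
  · exact absurd rfl h

/-! ### (s3) The recursive certificate -/

/-- `WaffR k` is monotone when the slope of piece `k` is nonnegative. [folklore] -/
theorem WaffR_mono {k : ℕ} (hs : 0 ≤ slope k) {x y : ℝ} (hxy : x ≤ y) : WaffR k x ≤ WaffR k y := by
  simp only [WaffR]
  have : (0 : ℝ) ≤ (slope k : ℝ) := by exact_mod_cast hs
  nlinarith

/-- Profile values on a sub-box lie in the checker's `W`-interval. [folklore] -/
theorem mem_WaffR {k : ℕ} (hs : 0 ≤ slope k) {p q : ℚ} {w : ℝ} (hw : I.mem ⟨p, q⟩ w) :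
    I.mem ⟨Waff k p, Waff k q⟩ (WaffR k w) := by
  constructor
  · have := WaffR_mono hs hw.1
    rwa [WaffR_cast] at this
  · have := WaffR_mono hs hw.2
    rwa [WaffR_cast] at this

/-- **Soundness of the recursive certificate:** a certified box satisfies the target inequality at every real point, for the
affine profile values of the two pieces. [folklore] -/
theorem certBox_sound {ka kb : ℕ} (hsa : 0 ≤ slope ka) (hsb : 0 ≤ slope kb) :
    ∀ (fuel : ℕ) (p q r s : ℚ), certBox ka kb fuel p q r s = true →
      ∀ {w₁ w₂ c : ℝ}, I.mem ⟨p, q⟩ w₁ → I.mem ⟨r, s⟩ w₂ → 0 ≤ w₁ → 0 ≤ w₂ → 0 ≤ WaffR ka w₁ → 0 ≤ WaffR kb w₂ →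
        -1 ≤ c → c ≤ 1 → 4 * w₁ * w₂ * c ≤ Epoly w₁ w₂ → Tpoly (WaffR ka w₁) (WaffR kb w₂) c ≤ 0 := by
  intro fuel
  induction fuel with
  | zero => intro p q r s h; simp [certBox] at h
  | succ n ih =>
    intro p q r s h w₁ w₂ c hw₁ hw₂ hw₁0 hw₂0 hW₁0 hW₂0 hc1 hc2 hcon
    unfold certBox at h
    split_ifs at h with h0 hlong
    · exact decideBox_sound h0 hw₁ hw₂ (mem_WaffR hsa hw₁) (mem_WaffR hsb hw₂) hw₁0 hw₂0 hW₁0 hW₂0 hc1 hc2 hcon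
    · -- bisect [p, q]
      rw [Bool.and_eq_true] at h
      rcases le_total w₁ (((p + q) / 2 : ℚ) : ℝ) with hle | hle
      · exact ih p ((p + q) / 2) r s h.1 ⟨hw₁.1, hle⟩ hw₂ hw₁0 hw₂0 hW₁0 hW₂0 hc1 hc2 hcon
      · exact ih ((p + q) / 2) q r s h.2 ⟨hle, hw₁.2⟩ hw₂ hw₁0 hw₂0 hW₁0 hW₂0 hc1 hc2 hcon
    · -- bisect [r, s]
      rw [Bool.and_eq_true] at h
      rcases le_total w₂ (((r + s) / 2 : ℚ) : ℝ) with hle | hle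
      · exact ih p q r ((r + s) / 2) h.1 hw₁ ⟨hw₂.1, hle⟩ hw₁0 hw₂0 hW₁0 hW₂0 hc1 hc2 hcon
      · exact ih p q ((r + s) / 2) s h.2 hw₁ ⟨hle, hw₂.2⟩ hw₁0 hw₂0 hW₁0 hW₂0 hc1 hc2 hcon

/-- The certificate of a piece pair, unfolded: on `[w_ka, w_ka+1] × [w_kb, w_kb+1]` the target inequality holds for the affine
profile values. [folklore] -/
theorem certPair_sound {ka kb : ℕ} (hsa : 0 ≤ slope ka) (hsb : 0 ≤ slope kb) (h : certPair ka kb = true) {w₁ w₂ c : ℝ}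
    (hw₁ : I.mem ⟨nodesW[ka]!, nodesW[ka+1]!⟩ w₁) (hw₂ : I.mem ⟨nodesW[kb]!, nodesW[kb+1]!⟩ w₂) (hw₁0 : 0 ≤ w₁)
    (hw₂0 : 0 ≤ w₂) (hW₁0 : 0 ≤ WaffR ka w₁) (hW₂0 : 0 ≤ WaffR kb w₂) (hc1 : -1 ≤ c) (hc2 : c ≤ 1)
    (hcon : 4 * w₁ * w₂ * c ≤ Epoly w₁ w₂) : Tpoly (WaffR ka w₁) (WaffR kb w₂) c ≤ 0 :=
  certBox_sound hsa hsb fuel0 _ _ _ _ h hw₁ hw₂ hw₁0 hw₂0 hW₁0 hW₂0 hc1 hc2 hcon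

end CertW

end Summit.Ventures.Crystal3D.TammesBridge
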